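import Mathlib.Algebra.Order.Ring.Defs
import Mathlib.Algebra.Order.Monoid.Canonical.Defs
import Mathlib.Algebra.Order.Sub.Defs
import Literature.Computability.MetaComplexity.BoundedArithDefinability
import HarnessLib

/-!
# Models of `BASIC` and of `T₂¹` as ordered semirings

Trunk: CplxMeta (G14), topic `Literature/Computability/MetaComplexity`.  First layer of the
bootstrapping of Buss's theories inside an arbitrary model (Buss 1986, §§2.2–2.3): the algebraic
and order-theoretic consequences of `BASIC`, and of `BASIC + Σᵇ₁-IND` (`T₂¹`), packaged as
Mathlib type-class instances on the carrier so that Mathlib's ordered-algebra library applies.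

All instances are `scoped` in the namespace `Literature.CplxMeta.BASICModel` and every one of them —
including the bare notation instances `Zero M`, `One M`, `Add M`, `Mul M` — takes the instance
argument `[M ⊨ BASIC]` (they are instances on an arbitrary type `M` carrying a
`Language.boundedArith`-structure which is a model of `BASIC`, resp. of `BASIC` and the scheme
`Σᵇ₁-IND`; open the namespace to use them).  Consequently opening the namespace puts *no*
instance on a concrete carrier such as `ℕ` (which carries a `Language.boundedArith`-structure,
`BoundedArithSyntax`) unless an *instance* `ℕ ⊨ BASIC` is registered — none is, and none should
be: state such facts as theorems (cf. the design note of `BoundedArithModels.lean`):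

* from `M ⊨ BASIC`: `LinearOrder M` (axioms 6–8), `OrderBot M` (axiom 3), `NonAssocSemiring M`
  with commutative `+`, `·` (axioms 21–29), `IsOrderedCancelAddMonoid M` (axiom 25),
  successor / discreteness facts (axioms 1, 2, 4), halving and parity (axiom 32), the axioms on
  `|·|` and `#` (9–18, 31) in algebraic notation, and `1 # 1 = 2`;
* from `M ⊨ BASIC + Σᵇ₁-IND`: associativity of `·` (hence `CommSemiring M`),
  `IsStrictOrderedRing M`, `CanonicallyOrderedAdd M` (existence of differences), truncated
  subtraction `Sub M` with `OrderedSub M`, `Πᵇ₁`-induction and the `Σᵇ₁` least-number principle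
  (Buss 1986, §2.3, Thms. 2.2–2.5 area; Krajíček 1995, §5.2).

## References

* S. R. Buss, *Bounded Arithmetic*, Bibliopolis 1986, §§2.2–2.3.
* J. Krajíček, *Bounded Arithmetic, Propositional Logic and Complexity Theory*, CUP 1995, §5.2.

## Design choices

* The hypotheses are the instance arguments `[M ⊨ BASIC]` and `[M ⊨ INDScheme (sigmabFormulas 1)]`
  (Mathlib's `Theory.Model` is a class); a model of `T₂ⁱ`, `i ≥ 1`, provides both
  (`T2 i = BASIC ∪ Σᵇᵢ-IND` and cumulativity).
* The notation instances keep the default priority (so that inside a `[M ⊨ BASIC]` context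
  `0, 1, +, ·` elaborate to them and not through the semiring instances of the `T₂¹` tier, which
  would drag the `Σᵇ₁-IND` hypothesis into statements that do not need it) but are guarded by
  `[M ⊨ BASIC]`, so that they never fire on Mathlib's concrete carriers.
* Names: lemmas analogous to a Mathlib root lemma are primed (`lt_add_one'`, `mul_assoc'`, …)
  when the primed name is free in Mathlib, and suffixed `_model` when Mathlib already uses the
  primed name (`bot_eq_zero_model`, `mul_comm_model`), so that opening the namespace creates no
  ambiguity with a Mathlib root lemma.
* Normal forms: `mZero = 0`, `mOne = 1`, `mSucc a = a + 1`, `mTwo = 2`, `mAdd = (+)`,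
  `mMul = (*)`, `MLe = (≤)` are `simp` lemmas, so that statements produced by the definability
  API (`BoundedArithDefinability`) are rewritten into algebraic notation; `mHalf`, `mLen`,
  `mSmash` keep their names.
-/

namespace Literature.Computability.MetaComplexity

open FirstOrder FirstOrder.Language

namespace BASICModel

variable {M : Type} [Language.boundedArith.Structure M]

/-! ## Notation: `0, 1, +, ·` of a model of `BASIC` -/

/-- `0` of a model of `BASIC` (guarded by `[M ⊨ BASIC]`, see the module docstring). [folklore] -/
scoped instance instZero [M ⊨ BASIC] : Zero M := ⟨mZero M⟩
/-- `1 = S0` of a model of `BASIC` (guarded by `[M ⊨ BASIC]`). [folklore] -/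
scoped instance instOne [M ⊨ BASIC] : One M := ⟨mOne M⟩
/-- `+` of a model of `BASIC` (guarded by `[M ⊨ BASIC]`). [folklore] -/
scoped instance instAdd [M ⊨ BASIC] : Add M := ⟨mAdd⟩
/-- `·` of a model of `BASIC` (guarded by `[M ⊨ BASIC]`). [folklore] -/
scoped instance instMul [M ⊨ BASIC] : Mul M := ⟨mMul⟩

section BASIC

variable [hB : M ⊨ BASIC]

/-- `mZero = 0`. [folklore] -/
@[simp] theorem mZero_eq : mZero M = 0 := rfl
/-- `mOne = 1`. [folklore] -/
@[simp] theorem mOne_eq : mOne M = 1 := rfl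
/-- `mAdd = (+)`. [folklore] -/
@[simp] theorem mAdd_eq (a b : M) : mAdd a b = a + b := rfl
/-- `mMul = (*)`. [folklore] -/
@[simp] theorem mMul_eq (a b : M) : mMul a b = a * b := rfl

/-! ## Order -/

/-- A model of `BASIC` is linearly ordered by `≤` (axioms 6, 7, 8). [cite: Buss1986, §2.2] -/
noncomputable scoped instance instLinearOrder : LinearOrder M where
  le := MLe
  le_refl a := (basic_le_total hB a a).elim id id
  le_trans a b c := basic_le_trans hB a b c
  le_antisymm a b := basic_le_antisymm hB a b
  le_total a b := (basic_le_total hB a b).symm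
  toDecidableLE := Classical.decRel _

/-- `MLe` is `≤`. [folklore] -/
@[simp] theorem mLe_iff (a b : M) : MLe a b ↔ a ≤ b := Iff.rfl

/-- `Sa = a + 1` (axioms 22, 23). [cite: Buss1986, §2.2] -/
@[simp] theorem mSucc_eq (a : M) : mSucc a = a + 1 := by
  change mSucc a = mAdd a (mSucc (mZero M))
  rw [basic_add_succ hB, basic_add_zero hB]

/-- `0 ≤ a` (axiom 3): a model of `BASIC` has bottom element `0`. [cite: Buss1986, §2.2] -/
scoped instance instOrderBot : OrderBot M where
  bot := 0
  bot_le a := basic_zero_le hB a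

/-- `⊥ = 0` (named so as not to clash with Mathlib's root `bot_eq_zero'`). [folklore] -/
@[simp] theorem bot_eq_zero_model : (⊥ : M) = 0 := rfl

/-! ## Additive and multiplicative structure (axioms 21–29) -/

/-- A model of `BASIC` is a (not yet associative) commutative semiring: axioms 21–24, 26–29.
[cite: Buss1986, §2.2] -/
scoped instance instNonAssocSemiring : NonAssocSemiring M where
  add_assoc := basic_add_assoc hB
  zero_add a := show mAdd (mZero M) a = a by rw [basic_add_comm hB, basic_add_zero hB]
  add_zero := basic_add_zero hB
  add_comm := basic_add_comm hB
  nsmul := nsmulRec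
  left_distrib := basic_mul_add hB
  right_distrib a b c := show mMul (mAdd a b) c = mAdd (mMul a c) (mMul b c) by
    rw [basic_mul_comm hB, basic_mul_add hB, basic_mul_comm hB c a, basic_mul_comm hB c b]
  zero_mul a := show mMul (mZero M) a = mZero M by rw [basic_mul_comm hB, basic_mul_zero hB]
  mul_zero := basic_mul_zero hB
  one_mul a := show mMul (mSucc (mZero M)) a = a by
    rw [basic_mul_comm hB, basic_mul_succ hB, basic_mul_zero hB, basic_add_comm hB,
      basic_add_zero hB]
  mul_one a := show mMul a (mSucc (mZero M)) = a by
    rw [basic_mul_succ hB, basic_mul_zero hB, basic_add_comm hB, basic_add_zero hB]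

/-- `·` is commutative in a model of `BASIC` (axiom 28). [cite: Buss1986, §2.2] -/
theorem mul_comm_model (a b : M) : a * b = b * a := basic_mul_comm hB a b

/-- `mTwo = 2`. [folklore] -/
@[simp] theorem mTwo_eq : mTwo M = 2 := by
  change mSucc (mSucc (mZero M)) = 2
  rw [mSucc_eq, mSucc_eq, mZero_eq, zero_add, one_add_one_eq_two]

/-- Addition is order-cancellative in a model of `BASIC` (axiom 25). [cite: Buss1986, §2.2] -/
scoped instance instIsOrderedCancelAddMonoid : IsOrderedCancelAddMonoid M where
  add_le_add_left a b h c := by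
    rw [add_comm a c, add_comm b c]
    exact (basic_add_le_add_iff_left hB c a b).2 h
  le_of_add_le_add_left a b c h := (basic_add_le_add_iff_left hB a b c).1 h

/-- `0 ≤ 1` in a model of `BASIC`. [folklore] -/
scoped instance instZeroLEOneClass : ZeroLEOneClass M := ⟨bot_le⟩

/-! ## Successor and discreteness (axioms 1, 2, 4, 19, 20) -/

/-- `a ≠ a + 1` (axiom 2). [cite: Buss1986, §2.2] -/
theorem ne_add_one (a : M) : a ≠ a + 1 := by simpa using basic_ne_succ_self hB a

/-- `a < b ↔ a + 1 ≤ b` (axiom 4: the order is discrete). [cite: Buss1986, §2.2] -/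
theorem add_one_le_iff' (a b : M) : a + 1 ≤ b ↔ a < b := by
  rw [lt_iff_le_and_ne]
  simpa using (basic_le_and_ne_iff_succ_le hB a b).symm

/-- `a < a + 1`. [cite: Buss1986, §2.2] -/
theorem lt_add_one' (a : M) : a < a + 1 := (add_one_le_iff' a _).1 le_rfl

/-- `a < b + 1 ↔ a ≤ b` (axioms 4, 6). [cite: Buss1986, §2.2] -/
theorem lt_add_one_iff' (a b : M) : a < b + 1 ↔ a ≤ b := by
  rw [← not_le, add_one_le_iff', not_lt]

/-- `a ≤ b → a ≤ b + 1` (axiom 1). [cite: Buss1986, §2.2] -/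
theorem le_add_one_of_le (a b : M) (h : a ≤ b) : a ≤ b + 1 := by
  simpa using basic_le_succ_of_le hB b a h

/-- `0 < 1` in a model of `BASIC`: it is nontrivial. [folklore] -/
scoped instance instNontrivial : Nontrivial M := ⟨⟨0, 1, by simpa using ne_add_one (0 : M)⟩⟩

/-- A model of `BASIC` has no maximal element. [folklore] -/
scoped instance instNoMaxOrder : NoMaxOrder M := ⟨fun a => ⟨a + 1, lt_add_one' a⟩⟩

/-- `0 < a ↔ a ≠ 0`. [folklore] -/
theorem pos_iff_ne_zero' (a : M) : 0 < a ↔ a ≠ 0 := bot_lt_iff_ne_bot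

/-- `1 ≤ a ↔ a ≠ 0`. [folklore] -/
theorem one_le_iff_ne_zero' (a : M) : 1 ≤ a ↔ a ≠ 0 := by
  rw [← zero_add (1 : M), add_one_le_iff', pos_iff_ne_zero']

/-- `a ≤ a + b` (axiom 19). [cite: Buss1986, §2.2] -/
theorem le_add_right'' (a b : M) : a ≤ a + b := basic_le_add_right hB a b

/-- `a ≤ b + a`. [cite: Buss1986, §2.2] -/
theorem le_add_left'' (a b : M) : a ≤ b + a := by
  rw [add_comm]
  exact le_add_right'' a b

/-- Cancellation of `+` (from axiom 25 and antisymmetry). [cite: Buss1986, §2.2] -/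
scoped instance instIsCancelAdd : IsCancelAdd M where
  add_left_cancel a b c h := le_antisymm (le_of_add_le_add_left h.le) (le_of_add_le_add_left h.ge)
  add_right_cancel a b c h := by
    have h' : a + b = a + c := by
      have h0 : b + a = c + a := h
      rwa [add_comm b a, add_comm c a] at h0
    exact le_antisymm (le_of_add_le_add_left h'.le) (le_of_add_le_add_left h'.ge)

/-- `a < b → 2a + 1 < 2b` (axiom 20). [cite: Buss1986, §2.2] -/
theorem two_mul_add_one_lt_two_mul (a b : M) (h : a < b) : 2 * a + 1 < 2 * b := by
  have h' := basic_succ_two_mul_lt_two_mul hB a b h.le h.ne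
  simp only [mMul_eq, mSucc_eq, mZero_eq, zero_add, one_add_one_eq_two, mLe_iff] at h'
  exact lt_of_le_of_ne h'.1 h'.2

/-- Multiplication by an element `≥ 1` is order-reflecting and -preserving (axiom 30).
[cite: Buss1986, §2.2] -/
theorem mul_le_mul_iff_left' {a : M} (ha : 1 ≤ a) (b c : M) : a * b ≤ a * c ↔ b ≤ c :=
  basic_mul_le_mul_iff_left hB a b c ha

/-- Cancellation of multiplication by an element `≥ 1` (axiom 30). [cite: Buss1986, §2.2] -/
theorem mul_left_cancel_of_one_le {a b c : M} (ha : 1 ≤ a) (h : a * b = a * c) : b = c :=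
  le_antisymm ((mul_le_mul_iff_left' ha b c).1 h.le) ((mul_le_mul_iff_left' ha c b).1 h.ge)

/-- Multiplication is monotone in each argument in a model of `BASIC` (axioms 26–30).
[cite: Buss1986, §2.2] -/
theorem mul_le_mul'' {a b c d : M} (hab : a ≤ b) (hcd : c ≤ d) : a * c ≤ b * d := by
  have h1 : ∀ x y z : M, y ≤ z → x * y ≤ x * z := by
    intro x y z h
    rcases eq_or_ne x 0 with rfl | hx
    · simp
    · exact (mul_le_mul_iff_left' ((one_le_iff_ne_zero' x).2 hx) y z).2 h
  calc a * c ≤ a * d := h1 a c d hcd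
    _ = d * a := mul_comm_model a d
    _ ≤ d * b := h1 d a b hab
    _ = b * d := mul_comm_model d b

/-! ## Halving and parity (axioms 5, 32) -/

/-- `x = ⌊y/2⌋ ↔ 2x = y ∨ 2x + 1 = y` (axiom 32). [cite: Buss1986, §2.2] -/
theorem eq_mHalf_iff (x y : M) : x = mHalf y ↔ 2 * x = y ∨ 2 * x + 1 = y := by
  simpa [one_add_one_eq_two] using basic_eq_half_iff hB x y

/-- Every element is `2⌊a/2⌋` or `2⌊a/2⌋ + 1` (axiom 32). [cite: Buss1986, §2.2] -/
theorem two_mul_mHalf_or (a : M) : 2 * mHalf a = a ∨ 2 * mHalf a + 1 = a :=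
  (eq_mHalf_iff _ _).1 rfl

/-- `⌊2x/2⌋ = x` (axiom 32). [cite: Buss1986, §2.2] -/
@[simp] theorem mHalf_two_mul (x : M) : mHalf (2 * x) = x :=
  ((eq_mHalf_iff x (2 * x)).2 (Or.inl rfl)).symm

/-- `⌊(2x+1)/2⌋ = x` (axiom 32). [cite: Buss1986, §2.2] -/
@[simp] theorem mHalf_two_mul_add_one (x : M) : mHalf (2 * x + 1) = x :=
  ((eq_mHalf_iff x (2 * x + 1)).2 (Or.inr rfl)).symm

/-- `⌊0/2⌋ = 0`. [cite: Buss1986, §2.2] -/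
@[simp] theorem mHalf_zero : mHalf (0 : M) = 0 := by simpa using mHalf_two_mul (0 : M)

/-- `⌊1/2⌋ = 0`. [cite: Buss1986, §2.2] -/
@[simp] theorem mHalf_one : mHalf (1 : M) = 0 := by simpa using mHalf_two_mul_add_one (0 : M)

/-- `2x ≤ 2y ↔ x ≤ y` (axiom 30). [cite: Buss1986, §2.2] -/
theorem two_mul_le_two_mul_iff (x y : M) : 2 * x ≤ 2 * y ↔ x ≤ y :=
  mul_le_mul_iff_left' (by rw [← one_add_one_eq_two]; exact le_add_left'' 1 1) x y

/-- `2x = 2y → x = y`. [cite: Buss1986, §2.2] -/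
theorem two_mul_cancel {x y : M} (h : 2 * x = 2 * y) : x = y :=
  mul_left_cancel_of_one_le (by rw [← one_add_one_eq_two]; exact le_add_left'' 1 1) h

/-- An even element is not odd: `2x ≠ 2y + 1` (axioms 2, 20). [cite: Buss1986, §2.2] -/
theorem two_mul_ne_two_mul_add_one (x y : M) : 2 * x ≠ 2 * y + 1 := by
  intro h
  rcases lt_trichotomy x y with hxy | rfl | hyx
  · have := two_mul_add_one_lt_two_mul x y hxy
    rw [h] at this
    exact absurd this (not_lt.2 ((le_add_right'' _ _).trans (le_add_right'' _ _)))
  · exact ne_add_one _ h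
  · have := two_mul_add_one_lt_two_mul y x hyx
    rw [← h] at this
    exact lt_irrefl _ this

/-- `a ≠ 0 → 2a ≠ 0` (axiom 5). [cite: Buss1986, §2.2] -/
theorem two_mul_ne_zero' {a : M} (ha : a ≠ 0) : 2 * a ≠ 0 := by
  simpa [one_add_one_eq_two] using basic_two_mul_ne_zero hB a ha

/-- `⌊a/2⌋ ≤ a`. [folklore] -/
theorem mHalf_le (a : M) : mHalf a ≤ a := by
  rcases two_mul_mHalf_or a with h | h
  · conv_rhs => rw [← h, ← one_add_one_eq_two, add_mul, one_mul]
    exact le_add_right'' _ _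
  · conv_rhs => rw [← h, ← one_add_one_eq_two, add_mul, one_mul, add_assoc]
    exact le_add_right'' _ _

/-- `a ≠ 0 → ⌊a/2⌋ < a`. [folklore] -/
theorem mHalf_lt {a : M} (ha : a ≠ 0) : mHalf a < a := by
  rcases two_mul_mHalf_or a with h | h
  · have hh : mHalf a ≠ 0 := by
      rintro h0
      rw [h0, mul_zero] at h
      exact ha h.symm
    conv_rhs => rw [← h, ← one_add_one_eq_two, add_mul, one_mul]
    calc mHalf a < mHalf a + 1 := lt_add_one' _
      _ ≤ mHalf a + mHalf a := by
        rw [add_le_add_iff_left]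
        exact (one_le_iff_ne_zero' _).2 hh
  · conv_rhs => rw [← h, ← one_add_one_eq_two, add_mul, one_mul, add_assoc]
    calc mHalf a < mHalf a + 1 := lt_add_one' _
      _ ≤ mHalf a + (mHalf a + 1) := by
        rw [add_le_add_iff_left]
        exact le_add_left'' _ _

/-! ## Length (axioms 9–12, 31) -/

/-- `|0| = 0` (axiom 9). [cite: Buss1986, §2.2] -/
@[simp] theorem mLen_zero : mLen (0 : M) = 0 := basic_len_zero hB

/-- `|1| = 1` (axiom 11). [cite: Buss1986, §2.2] -/
@[simp] theorem mLen_one : mLen (1 : M) = 1 := basic_len_one hB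

/-- `x ≠ 0 → |2x| = |x| + 1` (axiom 10). [cite: Buss1986, §2.2] -/
theorem mLen_two_mul {x : M} (hx : x ≠ 0) : mLen (2 * x) = mLen x + 1 := by
  simpa [one_add_one_eq_two] using (basic_len_two_mul hB x hx).1

/-- `|2x + 1| = |x| + 1` (axiom 10 for `x ≠ 0`; axioms 9, 11 for `x = 0`). [cite: Buss1986, §2.2] -/
theorem mLen_two_mul_add_one (x : M) : mLen (2 * x + 1) = mLen x + 1 := by
  rcases eq_or_ne x 0 with rfl | hx
  · simp
  · simpa [one_add_one_eq_two] using (basic_len_two_mul hB x hx).2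

/-- `|·|` is monotone (axiom 12). [cite: Buss1986, §2.2] -/
theorem mLen_le_mLen {x y : M} (h : x ≤ y) : mLen x ≤ mLen y := basic_len_le_len hB x y h

/-- `x ≠ 0 → |x| = |⌊x/2⌋| + 1` (axiom 31). [cite: Buss1986, §2.2] -/
theorem mLen_eq_mLen_mHalf_add_one {x : M} (hx : x ≠ 0) : mLen x = mLen (mHalf x) + 1 := by
  simpa using basic_len_eq_succ_len_half hB x hx

/-- `|x| = 0 ↔ x = 0` (axioms 9, 31). [cite: Buss1986, §2.2] -/
theorem mLen_eq_zero_iff (x : M) : mLen x = 0 ↔ x = 0 := by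
  refine ⟨fun h => by_contra fun hx => ?_, fun h => h ▸ mLen_zero⟩
  rw [mLen_eq_mLen_mHalf_add_one hx] at h
  exact (lt_of_le_of_lt bot_le (lt_add_one' _)).ne' h

/-- `|x| < |y| → x < y` (contrapositive of axiom 12). [cite: Buss1986, §2.2] -/
theorem lt_of_mLen_lt_mLen {x y : M} (h : mLen x < mLen y) : x < y :=
  lt_of_not_ge fun h' => (mLen_le_mLen h').not_gt h

/-! ## Smash (axioms 13–18) -/

/-- `|x # y| = |x|·|y| + 1` (axiom 13). [cite: Buss1986, §2.2] -/
theorem mLen_mSmash (x y : M) : mLen (mSmash x y) = mLen x * mLen y + 1 := by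
  simpa using basic_len_smash hB x y

/-- `0 # y = 1` (axiom 14). [cite: Buss1986, §2.2] -/
@[simp] theorem zero_mSmash (y : M) : mSmash 0 y = 1 := basic_zero_smash hB y

/-- `x # y = y # x` (axiom 16). [cite: Buss1986, §2.2] -/
theorem mSmash_comm (x y : M) : mSmash x y = mSmash y x := basic_smash_comm hB x y

/-- `y # 0 = 1` (axioms 14, 16). [cite: Buss1986, §2.2] -/
@[simp] theorem mSmash_zero (y : M) : mSmash y 0 = 1 := by rw [mSmash_comm, zero_mSmash]

/-- `x ≠ 0 → 1 # (2x) = 2·(1 # x)` (axiom 15). [cite: Buss1986, §2.2] -/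
theorem one_mSmash_two_mul {x : M} (hx : x ≠ 0) : mSmash 1 (2 * x) = 2 * mSmash 1 x := by
  simpa [one_add_one_eq_two] using (basic_one_smash_two_mul hB x hx).1

/-- `x ≠ 0 → 1 # (2x + 1) = 2·(1 # x)` (axiom 15). [cite: Buss1986, §2.2] -/
theorem one_mSmash_two_mul_add_one' {x : M} (hx : x ≠ 0) :
    mSmash 1 (2 * x + 1) = 2 * mSmash 1 x := by
  simpa [one_add_one_eq_two] using (basic_one_smash_two_mul hB x hx).2

/-- `|x| = |y| → x # z = y # z` (axiom 17): `x # z` depends only on `|x|`. [cite: Buss1986, §2.2] -/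
theorem mSmash_congr_left {x y : M} (h : mLen x = mLen y) (z : M) : mSmash x z = mSmash y z :=
  basic_smash_eq_smash_of_len_eq hB x y z h

/-- `|x| = |u| + |v| → x # y = (u # y)·(v # y)` (axiom 18). [cite: Buss1986, §2.2] -/
theorem mSmash_eq_mul_of_mLen_eq_add {x u v : M} (h : mLen x = mLen u + mLen v) (y : M) :
    mSmash x y = mSmash u y * mSmash v y := by
  simpa using basic_smash_eq_mul_smash_of_len_eq_add hB x y u v (by simpa using h)

/-- `x # y ≠ 0` (its length is a successor). [folklore] -/
theorem mSmash_ne_zero (x y : M) : mSmash x y ≠ 0 := by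
  intro h
  have := mLen_mSmash x y
  rw [h, mLen_zero] at this
  exact (lt_of_le_of_lt bot_le (lt_add_one' _)).ne this

/-- `|2| = 2`. [folklore] -/
@[simp] theorem mLen_two : mLen (2 : M) = 2 := by
  have := mLen_two_mul (x := (1 : M)) one_ne_zero
  rwa [mul_one, mLen_one, one_add_one_eq_two] at this

/-- `1 # 1 = 2`: from `1 # 2 = 2·(1 # 1)` (axiom 15), `2 # 1 = (1 # 1)²` (axiom 18 with
`|2| = |1| + |1|`), commutativity and cancellation. [cite: Buss1986, §2.2] -/
@[simp] theorem one_mSmash_one : mSmash (1 : M) 1 = 2 := by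
  have h1 : mSmash (1 : M) 2 = 2 * mSmash 1 1 := by
    simpa using one_mSmash_two_mul (x := (1 : M)) one_ne_zero
  have h2 : mSmash (2 : M) 1 = mSmash 1 1 * mSmash 1 1 :=
    mSmash_eq_mul_of_mLen_eq_add (by simp [one_add_one_eq_two]) 1
  rw [mSmash_comm, h2, mul_comm_model 2] at h1
  have hne : mSmash (1 : M) 1 ≠ 0 := mSmash_ne_zero 1 1
  exact mul_left_cancel_of_one_le ((one_le_iff_ne_zero' _).2 hne) h1

end BASIC

/-! ## Small-arity forms of the definability closure lemmas

Convenience restatements of the closure properties of `BoundedArithDefinability` for predicates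
written as `fun v => R (v 0)`, `fun w => R (w 0) (w 1)`, in the algebraic notation of this
file. -/

section Arity

variable [hB : M ⊨ BASIC] {i : ℕ}

/-- `a ≤ b` is open-definable for term functions, algebraic notation. [folklore] -/
theorem isQFDef_le {m : ℕ} {F G : (Fin m → M) → M} (hF : IsTermFn F) (hG : IsTermFn G) :
    IsQFDef fun xs => F xs ≤ G xs :=
  IsQFDef.le hF hG

/-- `a < b` is open-definable for term functions. [folklore] -/
theorem isQFDef_lt {m : ℕ} {F G : (Fin m → M) → M} (hF : IsTermFn F) (hG : IsTermFn G) :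
    IsQFDef fun xs => F xs < G xs :=
  ((IsQFDef.le hF hG).and (IsQFDef.le hG hF).not).of_iff fun xs =>
    (lt_iff_le_not_ge (a := F xs) (b := G xs)).symm

/-- Term functions are closed under `+` (algebraic notation). [folklore] -/
theorem isTermFn_add {m : ℕ} {F G : (Fin m → M) → M} (hF : IsTermFn F) (hG : IsTermFn G) :
    IsTermFn fun xs => F xs + G xs :=
  hF.add hG

/-- Term functions are closed under `·` (algebraic notation). [folklore] -/
theorem isTermFn_mul {m : ℕ} {F G : (Fin m → M) → M} (hF : IsTermFn F) (hG : IsTermFn G) :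
    IsTermFn fun xs => F xs * G xs :=
  hF.mul hG

/-- `0` is a term function (algebraic notation). [folklore] -/
theorem isTermFn_zero {m : ℕ} : IsTermFn fun _ : Fin m → M => (0 : M) := IsTermFn.zero

/-- `1` is a term function (algebraic notation). [folklore] -/
theorem isTermFn_one {m : ℕ} : IsTermFn fun _ : Fin m → M => (1 : M) := IsTermFn.zero.succ

/-- `2` is a term function. [folklore] -/
theorem isTermFn_two {m : ℕ} : IsTermFn fun _ : Fin m → M => (2 : M) :=
  IsTermFn.const 2

end Arity

/-! ## `T₂¹`: models of `BASIC + Σᵇ₁-IND` -/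

section T21

variable [hB : M ⊨ BASIC] [hI : M ⊨ INDScheme (sigmabFormulas 1)]

/-- **`Σᵇ₁-IND`** in a model of `BASIC + Σᵇ₁-IND`, algebraic notation (Buss 1986, §2.4).
[cite: Buss1986, §2.4] -/
theorem ind {P : M → Prop} (hP : IsSigmabDef 1 fun v : Fin 1 → M => P (v 0)) (h0 : P 0)
    (hs : ∀ a, P a → P (a + 1)) (a : M) : P a :=
  hP.induction' hI h0 (fun a ha => by simpa using hs a ha) a

/-- `·` is associative: proved by `Σᵇ₁`- (indeed open) induction on `c` (Buss 1986, §2.3).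
[cite: Buss1986, §2.3] -/
theorem mul_assoc' (a b c : M) : a * b * c = a * (b * c) := by
  refine ind (P := fun c => a * b * c = a * (b * c)) ?_ (by simp) (fun c hc => ?_) c
  · exact (IsQFDef.eq (((IsTermFn.const a).mul (IsTermFn.const b)).mul (IsTermFn.proj 0))
      ((IsTermFn.const a).mul ((IsTermFn.const b).mul (IsTermFn.proj 0)))).isSigmabDef 1
  · rw [mul_add, mul_add, mul_add, hc, mul_one, mul_one]

/-- A model of `T₂¹` is a commutative semiring (Buss 1986, §2.3). [cite: Buss1986, §2.3] -/
scoped instance instCommSemiring : CommSemiring M :=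
  { BASICModel.instNonAssocSemiring with
    mul_assoc := mul_assoc'
    mul_comm := mul_comm_model }

/-- A model of `T₂¹` is a strictly ordered semiring (axioms 25, 30). [cite: Buss1986, §2.3] -/
scoped instance instIsStrictOrderedRing : IsStrictOrderedRing M where
  add_le_add_left a b h c := add_le_add_left h c
  le_of_add_le_add_left a b c h := le_of_add_le_add_left h
  zero_le_one := zero_le_one
  exists_pair_ne := ⟨0, 1, zero_ne_one⟩
  mul_lt_mul_of_pos_left a ha b c hbc := by
    have ha' : 1 ≤ a := (one_le_iff_ne_zero' a).2 ha.ne'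
    rw [lt_iff_not_ge] at hbc ⊢
    exact fun h => hbc ((mul_le_mul_iff_left' ha' c b).1 h)
  mul_lt_mul_of_pos_right a ha b c hbc := by
    have ha' : 1 ≤ a := (one_le_iff_ne_zero' a).2 ha.ne'
    rw [lt_iff_not_ge] at hbc ⊢
    rw [mul_comm b a, mul_comm c a]
    exact fun h => hbc ((mul_le_mul_iff_left' ha' c b).1 h)

/-- **Existence of differences**: `a ≤ b → ∃ c, b = a + c`, by `Σᵇ₁`-induction on `b` on the
formula `a ≤ b → ∃ c ≤ b (b = a + c)` (Buss 1986, §2.3: definition of `∸`).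
[cite: Buss1986, §2.3] -/
theorem exists_add_of_le' {a b : M} (h : a ≤ b) : ∃ c, b = a + c := by
  suffices H : a ≤ b → ∃ c, c ≤ b ∧ b = a + c by
    obtain ⟨c, -, hc⟩ := H h
    exact ⟨c, hc⟩
  refine ind (P := fun b => a ≤ b → ∃ c, c ≤ b ∧ b = a + c) ?_ ?_ ?_ b
  · refine IsSigmabDef.imp ((IsQFDef.le (IsTermFn.const a) (IsTermFn.proj 0)).isPibDef 1) ?_
    refine (IsSigmabDef.bexLE (i := 0) (R := fun w : Fin 2 → M => w 0 = a + w 1)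
      ((IsQFDef.eq (IsTermFn.proj 0) ((IsTermFn.const a).add (IsTermFn.proj 1))).isSigmabDef 1)
      (IsTermFn.proj 0)).of_iff fun v => ?_
    simp
  · intro h0
    exact ⟨0, le_rfl, by rw [le_antisymm h0 bot_le, add_zero]⟩
  · intro b ih hab
    rcases hab.eq_or_lt with rfl | hlt
    · exact ⟨0, bot_le, (add_zero _).symm⟩
    · obtain ⟨c, hcb, rfl⟩ := ih ((lt_add_one_iff' a b).1 hlt)
      exact ⟨c + 1, by simpa using hcb, add_assoc a c 1⟩

/-- A model of `T₂¹` is canonically ordered: `a ≤ b ↔ ∃ c, b = a + c` (Buss 1986, §2.3).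
[cite: Buss1986, §2.3] -/
scoped instance instCanonicallyOrderedAdd : CanonicallyOrderedAdd M where
  exists_add_of_le h := exists_add_of_le' h
  le_add_self a b := le_add_left'' a b
  le_self_add a b := le_add_right'' a b

/-- Every nonzero element is a successor (Buss 1986, §2.3). [cite: Buss1986, §2.3] -/
theorem exists_eq_add_one_of_ne_zero {a : M} (ha : a ≠ 0) : ∃ b, a = b + 1 := by
  obtain ⟨b, hb⟩ := exists_add_of_le' ((one_le_iff_ne_zero' a).2 ha)
  exact ⟨b, by rw [hb, add_comm]⟩

/-- Truncated subtraction `a ∸ b` of a model of `T₂¹`: the `c` with `b + c = a` if `b ≤ a`,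
and `0` otherwise (Buss 1986, §2.3). [cite: Buss1986, §2.3] -/
noncomputable scoped instance instSub : Sub M :=
  ⟨fun a b => if h : b ≤ a then Classical.choose (exists_add_of_le' h) else 0⟩

/-- `b ≤ a → b + (a ∸ b) = a`. [cite: Buss1986, §2.3] -/
theorem add_sub_cancel_of_le' {a b : M} (h : b ≤ a) : b + (a - b) = a := by
  change b + (if h : b ≤ a then Classical.choose (exists_add_of_le' h) else 0) = a
  rw [dif_pos h]
  exact (Classical.choose_spec (exists_add_of_le' h)).symm

/-- `a < b → a ∸ b = 0`. [cite: Buss1986, §2.3] -/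
theorem sub_eq_zero_of_lt' {a b : M} (h : a < b) : a - b = 0 := by
  change (if h : b ≤ a then Classical.choose (exists_add_of_le' h) else 0) = 0
  rw [dif_neg (not_le.2 h)]

/-- Truncated subtraction of a model of `T₂¹` is an ordered subtraction:
`a ∸ b ≤ c ↔ a ≤ c + b`. [cite: Buss1986, §2.3] -/
scoped instance instOrderedSub : OrderedSub M where
  tsub_le_iff_right a b c := by
    rcases le_or_gt b a with h | h
    · conv_rhs => rw [← add_sub_cancel_of_le' h, add_comm b]
      exact (add_le_add_iff_right b).symm
    · rw [sub_eq_zero_of_lt' h]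
      exact ⟨fun _ => h.le.trans (le_add_left'' b c), fun _ => bot_le⟩

/-- The graph of truncated subtraction is open-definable:
`c = a ∸ b ↔ (b ≤ a ∧ b + c = a) ∨ (a < b ∧ c = 0)` (Buss 1986, §2.3: `∸` is `Σᵇ₁`-definable
with a `Δᵇ`-graph). [cite: Buss1986, §2.3] -/
theorem isQFDef_sub_graph {m : ℕ} {F G H : (Fin m → M) → M}
    (hF : IsTermFn F) (hG : IsTermFn G) (hH : IsTermFn H) :
    IsQFDef fun xs => H xs = F xs - G xs := by
  refine (((IsQFDef.le hG hF).and (IsQFDef.eq (hG.add hH) hF)).or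
    ((isQFDef_lt hF hG).and (IsQFDef.eq hH IsTermFn.zero))).of_iff fun xs => ?_
  simp only [mLe_iff, mAdd_eq, mZero_eq]
  constructor
  · rintro (⟨-, h2⟩ | ⟨h1, h2⟩)
    · exact eq_tsub_of_add_eq (by rw [add_comm]; exact h2)
    · rw [h2, tsub_eq_zero_of_le h1.le]
  · intro hH
    rcases le_or_gt (G xs) (F xs) with h | h
    · exact Or.inl ⟨h, by rw [hH, add_tsub_cancel_of_le h]⟩
    · exact Or.inr ⟨h, by rw [hH, tsub_eq_zero_of_le h.le]⟩

/-- Truncated subtraction is a `Σᵇᵢ`-definable function (open graph, bounded by the minuend),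
for every `i` (Buss 1986, §2.3). [cite: Buss1986, §2.3] -/
theorem isSigmabFn_sub {m : ℕ} {F G : (Fin m → M) → M}
    (hF : IsTermFn F) (hG : IsTermFn G) (i : ℕ) : IsSigmabFn i fun xs => F xs - G xs := by
  refine ⟨?_, F, hF, fun xs => show F xs - G xs ≤ F xs from tsub_le_self⟩
  exact (isQFDef_sub_graph (hF.comp Fin.castSucc) (hG.comp Fin.castSucc)
    (IsTermFn.proj (Fin.last m))).isSigmabDef i |>.of_iff fun v => by rfl

/-- **`Πᵇ₁-IND`** in a model of `T₂¹`: induction holds for `Πᵇ₁`-definable predicates with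
parameters.  Proof: if `P(0)`, `∀x (P(x) → P(x+1))` and `¬P(a)`, the `Σᵇ₁` predicate
`B(x) :≡ ∃ y ≤ a (y + x = a ∧ ¬P(y))` is inductive, and `B(a + 1)` is absurd
(Buss 1986, §2.3, Thm. 2.5 area: `T₂ⁱ ⊢ Πᵇᵢ-IND`). [cite: Buss1986, §2.3] -/
theorem pib_ind {P : M → Prop} (hP : IsPibDef 1 fun v : Fin 1 → M => P (v 0)) (h0 : P 0)
    (hs : ∀ a, P a → P (a + 1)) (a : M) : P a := by
  by_contra ha
  have hB' : IsSigmabDef 1 fun v : Fin 1 → M => ∃ y, y ≤ a ∧ (y + v 0 = a ∧ ¬P y) := by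
    refine (IsSigmabDef.bexLE (i := 0) (R := fun w : Fin 2 → M => w 1 + w 0 = a ∧ ¬P (w 1))
      (IsSigmabDef.and ((IsQFDef.eq ((IsTermFn.proj 1).add (IsTermFn.proj 0))
        (IsTermFn.const a)).isSigmabDef 1) (hP.comp fun _ : Fin 1 => (1 : Fin 2)).not)
      (IsTermFn.const a)).of_iff fun v => ?_
    simp
  have hall := ind (P := fun x => ∃ y, y ≤ a ∧ (y + x = a ∧ ¬P y)) hB' ⟨a, le_rfl, by simp, ha⟩
    (fun x ⟨y, hya, hyx, hy⟩ => by
      have hy0 : y ≠ 0 := fun h => hy (h ▸ h0)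
      obtain ⟨y', rfl⟩ := exists_eq_add_one_of_ne_zero hy0
      refine ⟨y', (le_add_right'' y' 1).trans hya, ?_, fun h => hy (hs y' h)⟩
      rw [← hyx, add_assoc, add_comm 1 x]) (a + 1)
  obtain ⟨y, -, hy, -⟩ := hall
  have : a < y + (a + 1) := lt_of_lt_of_le (lt_add_one' a) (le_add_left'' _ _)
  exact this.ne' hy

/-- **`Σᵇ₁` least-number principle** in a model of `T₂¹`: a nonempty `Σᵇ₁`-definable set has
a least element (Buss 1986, §2.3: `T₂ⁱ ⊢ Σᵇᵢ-MIN`; via `Πᵇ₁-IND` on `∀ y ≤ x ¬P(y)`).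
[cite: Buss1986, §2.3] -/
theorem exists_least_of_sigmabDef {P : M → Prop} (hP : IsSigmabDef 1 fun v : Fin 1 → M => P (v 0))
    {a : M} (ha : P a) : ∃ m, P m ∧ ∀ k < m, ¬P k := by
  by_contra hno
  push Not at hno
  have hR : IsPibDef 1 fun v : Fin 1 → M => ∀ y, y ≤ v 0 → ¬P y := by
    refine (IsPibDef.ballLE (i := 0) (R := fun w : Fin 2 → M => ¬P (w 1))
      (hP.comp fun _ : Fin 1 => (1 : Fin 2)).not (IsTermFn.proj 0)).of_iff fun v => ?_
    simp
  refine absurd ha (pib_ind (P := fun x => ∀ y, y ≤ x → ¬P y) hR ?_ ?_ a a le_rfl)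
  · intro y hy hPy
    obtain ⟨k, hk, -⟩ := hno 0 (le_antisymm hy bot_le ▸ hPy)
    exact (not_lt_bot hk).elim
  · intro x hx y hy hPy
    rcases le_or_gt y x with hyx | hxy
    · exact hx y hyx hPy
    · have hy' : y = x + 1 := le_antisymm hy ((add_one_le_iff' x y).2 hxy)
      subst hy'
      obtain ⟨k, hk, hPk⟩ := hno (x + 1) hPy
      exact hx k ((lt_add_one_iff' k x).1 hk) hPk

/-- **`Σᵇ₁` maximum principle** in a model of `T₂¹`: a nonempty `Σᵇ₁`-definable set bounded
above has a greatest element (Buss 1986, §2.3: `Σᵇᵢ-MAX` in `T₂ⁱ`). [cite: Buss1986, §2.3] -/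
theorem exists_greatest_of_sigmabDef {P : M → Prop}
    (hP : IsSigmabDef 1 fun v : Fin 1 → M => P (v 0)) {a b : M} (ha : P a)
    (hb : ∀ x, P x → x ≤ b) : ∃ m, P m ∧ ∀ k, P k → k ≤ m := by
  -- least `d` with `∃ y ≤ b (P y ∧ y + d = b)`
  have hQ : IsSigmabDef 1 fun v : Fin 1 → M => ∃ y, y ≤ b ∧ (P y ∧ y + v 0 = b) := by
    refine (IsSigmabDef.bexLE (i := 0) (R := fun w : Fin 2 → M => P (w 1) ∧ w 1 + w 0 = b)
      ((hP.comp fun _ : Fin 1 => (1 : Fin 2)).and ((IsQFDef.eq ((IsTermFn.proj 1).add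
        (IsTermFn.proj 0)) (IsTermFn.const b)).isSigmabDef 1)) (IsTermFn.const b)).of_iff
      fun v => ?_
    simp
  obtain ⟨d, ⟨y, -, hPy, hyd⟩, hleast⟩ :=
    exists_least_of_sigmabDef (P := fun d => ∃ y, y ≤ b ∧ (P y ∧ y + d = b)) hQ (a := b - a)
      ⟨a, hb a ha, ha, add_tsub_cancel_of_le (hb a ha)⟩
  refine ⟨y, hPy, fun k hPk => ?_⟩
  by_contra hky
  push Not at hky
  have hkb := hb k hPk
  have hsum : k + (b - k) = y + d := by rw [add_tsub_cancel_of_le hkb, hyd]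
  have hlt : b - k < d := by
    by_contra hge
    push Not at hge
    have : y + d < k + (b - k) :=
      calc y + d ≤ y + (b - k) := by gcongr
        _ < k + (b - k) := by gcongr
    exact this.ne' hsum
  exact hleast (b - k) hlt ⟨k, hkb, hPk, add_tsub_cancel_of_le hkb⟩

end T21

/-! ## The same principles at level `i + 1`: models of `T₂ⁱ⁺¹ ⊇ T₂¹` -/

section Level

variable [hB : M ⊨ BASIC] {i : ℕ}

omit hB in
/-- A model of `BASIC + Σᵇᵢ₊₁-IND` satisfies `Σᵇ₁-IND` (cumulativity), so that the `T₂¹` tier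
applies. [folklore] -/
theorem model_INDScheme_one_of_level {N : Type} [Language.boundedArith.Structure N] {i : ℕ}
    (h : N ⊨ INDScheme (sigmabFormulas (i + 1))) : N ⊨ INDScheme (sigmabFormulas 1) :=
  h.mono (INDScheme_mono fun _ _ hφ => IsSigmab.mono_holds (Nat.le_add_left 1 i) hφ)

/-- **`Σᵇᵢ₊₁-IND`** in a model of `BASIC + Σᵇᵢ₊₁-IND`, algebraic notation (Buss 1986, §2.4).
[cite: Buss1986, §2.4] -/
theorem ind_level (hIi : M ⊨ INDScheme (sigmabFormulas (i + 1))) {P : M → Prop}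
    (hP : IsSigmabDef (i + 1) fun v : Fin 1 → M => P (v 0)) (h0 : P 0)
    (hs : ∀ a, P a → P (a + 1)) (a : M) : P a :=
  hP.induction' hIi h0 (fun a ha => by simpa using hs a ha) a

/-- **`Πᵇᵢ₊₁-IND`** in a model of `T₂ⁱ⁺¹` (Buss 1986, §2.3: `T₂ⁱ ⊢ Πᵇᵢ-IND`); same proof as
`pib_ind`. [cite: Buss1986, §2.3] -/
theorem pib_ind_level (hIi : M ⊨ INDScheme (sigmabFormulas (i + 1))) {P : M → Prop}
    (hP : IsPibDef (i + 1) fun v : Fin 1 → M => P (v 0)) (h0 : P 0)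
    (hs : ∀ a, P a → P (a + 1)) (a : M) : P a := by
  haveI := model_INDScheme_one_of_level hIi
  by_contra ha
  have hB' : IsSigmabDef (i + 1) fun v : Fin 1 → M => ∃ y, y ≤ a ∧ (y + v 0 = a ∧ ¬P y) := by
    refine (IsSigmabDef.bexLE (i := i) (R := fun w : Fin 2 → M => w 1 + w 0 = a ∧ ¬P (w 1))
      (IsSigmabDef.and ((IsQFDef.eq ((IsTermFn.proj 1).add (IsTermFn.proj 0))
        (IsTermFn.const a)).isSigmabDef (i + 1)) (hP.comp fun _ : Fin 1 => (1 : Fin 2)).not)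
      (IsTermFn.const a)).of_iff fun v => ?_
    simp
  have hall := ind_level hIi (P := fun x => ∃ y, y ≤ a ∧ (y + x = a ∧ ¬P y)) hB'
    ⟨a, le_rfl, by simp, ha⟩
    (fun x ⟨y, hya, hyx, hy⟩ => by
      have hy0 : y ≠ 0 := fun h => hy (h ▸ h0)
      obtain ⟨y', rfl⟩ := exists_eq_add_one_of_ne_zero hy0
      refine ⟨y', (le_add_right'' y' 1).trans hya, ?_, fun h => hy (hs y' h)⟩
      rw [← hyx, add_assoc, add_comm 1 x]) (a + 1)
  obtain ⟨y, -, hy, -⟩ := hall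
  have : a < y + (a + 1) := lt_of_lt_of_le (lt_add_one' a) (le_add_left'' _ _)
  exact this.ne' hy

/-- **`Σᵇᵢ₊₁` least-number principle** in a model of `T₂ⁱ⁺¹` (Buss 1986, §2.3: `Σᵇᵢ-MIN`);
same proof as `exists_least_of_sigmabDef`. [cite: Buss1986, §2.3] -/
theorem exists_least_level (hIi : M ⊨ INDScheme (sigmabFormulas (i + 1))) {P : M → Prop}
    (hP : IsSigmabDef (i + 1) fun v : Fin 1 → M => P (v 0)) {a : M} (ha : P a) :
    ∃ m, P m ∧ ∀ k < m, ¬P k := by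
  haveI := model_INDScheme_one_of_level hIi
  by_contra hno
  push Not at hno
  have hR : IsPibDef (i + 1) fun v : Fin 1 → M => ∀ y, y ≤ v 0 → ¬P y := by
    refine (IsPibDef.ballLE (i := i) (R := fun w : Fin 2 → M => ¬P (w 1))
      (hP.comp fun _ : Fin 1 => (1 : Fin 2)).not (IsTermFn.proj 0)).of_iff fun v => ?_
    simp
  refine absurd ha (pib_ind_level hIi (P := fun x => ∀ y, y ≤ x → ¬P y) hR ?_ ?_ a a le_rfl)
  · intro y hy hPy
    obtain ⟨k, hk, -⟩ := hno 0 (le_antisymm hy bot_le ▸ hPy)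
    exact (not_lt_bot hk).elim
  · intro x hx y hy hPy
    rcases le_or_gt y x with hyx | hxy
    · exact hx y hyx hPy
    · have hy' : y = x + 1 := le_antisymm hy ((add_one_le_iff' x y).2 hxy)
      subst hy'
      obtain ⟨k, hk, hPk⟩ := hno (x + 1) hPy
      exact hx k ((lt_add_one_iff' k x).1 hk) hPk

/-- **`Σᵇᵢ₊₁` maximum principle** in a model of `T₂ⁱ⁺¹` (Buss 1986, §2.3: `Σᵇᵢ-MAX`); same
proof as `exists_greatest_of_sigmabDef`. [cite: Buss1986, §2.3] -/
theorem exists_greatest_level (hIi : M ⊨ INDScheme (sigmabFormulas (i + 1))) {P : M → Prop}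
    (hP : IsSigmabDef (i + 1) fun v : Fin 1 → M => P (v 0)) {a b : M} (ha : P a)
    (hb : ∀ x, P x → x ≤ b) : ∃ m, P m ∧ ∀ k, P k → k ≤ m := by
  haveI := model_INDScheme_one_of_level hIi
  have hQ : IsSigmabDef (i + 1) fun v : Fin 1 → M => ∃ y, y ≤ b ∧ (P y ∧ y + v 0 = b) := by
    refine (IsSigmabDef.bexLE (i := i) (R := fun w : Fin 2 → M => P (w 1) ∧ w 1 + w 0 = b)
      ((hP.comp fun _ : Fin 1 => (1 : Fin 2)).and ((IsQFDef.eq ((IsTermFn.proj 1).add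
        (IsTermFn.proj 0)) (IsTermFn.const b)).isSigmabDef (i + 1))) (IsTermFn.const b)).of_iff
      fun v => ?_
    simp
  obtain ⟨d, ⟨y, -, hPy, hyd⟩, hleast⟩ :=
    exists_least_level hIi (P := fun d => ∃ y, y ≤ b ∧ (P y ∧ y + d = b)) hQ (a := b - a)
      ⟨a, hb a ha, ha, add_tsub_cancel_of_le (hb a ha)⟩
  refine ⟨y, hPy, fun k hPk => ?_⟩
  by_contra hky
  push Not at hky
  have hkb := hb k hPk
  have hsum : k + (b - k) = y + d := by rw [add_tsub_cancel_of_le hkb, hyd]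
  have hlt : b - k < d := by
    by_contra hge
    push Not at hge
    have : y + d < k + (b - k) :=
      calc y + d ≤ y + (b - k) := by gcongr
        _ < k + (b - k) := by gcongr
    exact this.ne' hsum
  exact hleast (b - k) hlt ⟨k, hkb, hPk, add_tsub_cancel_of_le hkb⟩

end Level

end BASICModel

end Literature.Computability.MetaComplexity
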